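import Summits.BirchSwinnertonDyer.Rank1Residual.GaloisImage.SelmerPairCounting
import Summits.BirchSwinnertonDyer.Rank1Residual.GaloisImage.KummerSelfDualCount
import Summits.BirchSwinnertonDyer.Rank1Residual.GaloisImage.PropagatedStructureKummer
import Summits.BirchSwinnertonDyer.Rank1Residual.GaloisImage.PropagatedStructureUnramified
import Literature.NumberTheory.EllipticCurves.WeilPairingProofs
import Literature.NumberTheory.EllipticCurves.SemistableModPImageAbelianProofs
import Literature.NumberTheory.GaloisRepresentations.LocalGlobalCohomologyFiniteProofs
import Literature.NumberTheory.GaloisRepresentations.ContinuousH1OrderTwo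
import HarnessLib

/-!
# The Poitou–Tate COUNT for the propagated structure at a deep level:
# `#H¹_{𝓕_can}(ℚ, E[p^{k+1}]) = p^{k+1} · #H¹_{𝓕_can^*}(ℚ, E[p^{k+1}]^∨(1))`
# (team n1011, ROUTE-1 sub-target R1-23, skeleton `cells/n1011/skel/T-R1-23.md` input "PT count",
# empty level; p18)

HONEST FRAMING (cell `b2b-bsdres`, run/shared/lean/b2b/bsd-rank1-residual/, verbatim in every
file): the goal of the cell is to DELETE the COMBINATION-SHAPED residual classes of the
Birch–Swinnerton-Dyer formula for ALL analytic-rank `≤ 1` elliptic curves over `ℚ` — "full BSD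
formula for every rank `≤ 1` curve in class `C`" assembled STRICTLY from published theorems — so
that the rank-`≤ 1` remainder becomes exactly the CONSTRUCTION-SHAPED classes, which are TYPED
(missing-input `Prop`s), NOT attempted. This is not "finishing BSD". Team n1011 (N10/N11, the
additive block `X4 ∧ p = 3`): research route; TOOL theorems, no class theorem, nothing booked, no
mark changed, no fact. CONDITIONAL (explicit hypotheses) on a Poitou–Tate family of local
invariant maps with its four typed properties + injectivity (`poitouTate_selmerStructure_duality`,
Howard 2004 Thm. 2.1.11 ⟸ Milne ADT I 4.10) and Tate's local Euler–Poincaré characteristic `hEP`.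

## What and why

The deep-level ledger of R1-23 (`KolyvaginDeepLedger.lean`) consumes the count
`#H¹_{𝓕_can}(ℚ, E[p^K]) = p^K · N_∅`, `N_∅ = #H¹_{𝓕_can^*}(ℚ, E[p^K]^D)`, `K = k + 1`.  It is p13's
PAIR-COUNTING Poitou–Tate formula `card_selmerGroup_pair` for the pair `𝓚 ≤ 𝓕_can` (classical Kummer
structure `≤` propagated structure; they differ only at the place `v_p`), combined with

* the residual self-duality count `#H¹_𝓚 = #H¹_{𝓚^*}` (p13 `natCard_selmerGroup_kummer_eq_dual`,
  Weil pairing from `exists_weilPairing_holds`; transported here from the modulus `(p^K : ℕ)` to the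
  modulus `p^k · p` of the propagated structure by `subst`, `natCard_selmerGroup_kummer_eq_dual_of_eq`);
* the LOCAL INDEX `#𝓕_can(v_p) = p^K · #𝓚(v_p)` from the dictionary's `Λ`-clauses (onto `ℤ/p^K` on
  `𝓕_can(v_p)` with kernel `𝓚(v_p)`; `natCard_propagated_inr_eq`);
* `𝓕_can,v = 𝓚_v` at finite `v ≠ v_p` (p05 `propagatedSelmerStructure_inr_eq_kummerSelmerStructure`)
  and `H¹ = 0` at infinite places (`p` odd).

Main: `natCard_selmerGroup_propagated_eq`.  Transverse levels `d ≠ ∅` are NOT covered: there the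
self-duality count of the MODIFIED Kummer structure needs the transverse orthogonality of the
invariant family ([MR04] Prop. 1.3.2 (ii)), a property the tree's Poitou–Tate fact does not carry
(skeleton §3, input M2′).

References: B. Mazur, K. Rubin, Mem. AMS 799 (2004) Thm. 2.3.4, Prop. 2.3.5 [MazurRubin2004];
B. Howard, Compos. Math. 140 (2004) Thm. 2.1.11; H. Darmon, F. Diamond, R. Taylor, *Fermat's Last
Theorem* Thm. 2.19; C.-H. Kim, AJM 148 (2026) Prop. 3.12 [Kim2022StructureSelmer].
-/

noncomputable section

open scoped Classical NumberField
open Function NumberField IsDedekindDomain WeierstrassCurve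
  Literature.NumberTheory.EllipticCurves
  Literature.NumberTheory.GaloisRepresentations
  Literature.NumberTheory.GaloisRepresentations.DiscreteGaloisModule Literature.NumberTheory.GaloisCohomology

namespace Summit.BirchSwinnertonDyer.Rank1Residual.GaloisImage

namespace DeepLedger

variable (W : WeierstrassCurve ℚ) [W.IsElliptic] (p : ℕ) [hp : Fact p.Prime] (k : ℕ)

/-! ## The self-duality count at the modulus `p^k · p` -/

/-- **`#H¹_𝓚(ℚ, E[n]) = #H¹_{𝓚^*}(ℚ, E[n]^D)` for a modulus `n : ℤ` equal to an odd prime power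
`(N : ℕ)`** — p13's `natCard_selmerGroup_kummer_eq_dual` (Weil pairing chosen inside by
`exists_weilPairing_holds`) transported along `n = N` (the propagated structure lives at the modulus
`p^k · p`, the cited count at `(p^{k+1} : ℕ)`). [cite: Sakamoto2024, Def. 3.9 (p. 924)] -/
theorem natCard_selmerGroup_kummer_eq_dual_of_eq (n : ℤ) (N : ℕ) [NeZero N] (hn : n = N)
    (hN : IsPrimePow N) (hodd : Odd N) [Finite (geomTorsion W n)]
    (inv : LocalInvariants ℚ N) (hinj : ∀ v : HeightOneSpectrum (𝓞 ℚ), Injective (inv (Sum.inr v)))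
    (hEP : ∀ v : HeightOneSpectrum (𝓞 ℚ), localEulerPoincareCharacteristic (v.adicCompletion ℚ))
    [Finite (W.kummerSelmerStructure n).selmerGroup] :
    Nat.card (W.kummerSelmerStructure n).selmerGroup =
      Nat.card (inv.dualSelmerStructure (W.torsionGaloisModule n)
        (W.kummerSelmerStructure n)).selmerGroup := by
  subst hn
  have h2 : 2 ≤ N := hN.two_le
  obtain ⟨e, hμ, hadd₁, hadd₂, halt, hnondeg, hgal⟩ :=
    exists_weilPairing_holds W N h2 (by exact_mod_cast (NeZero.ne N))
  exact natCard_selmerGroup_kummer_eq_dual W N e hμ hadd₁ hadd₂ hgal halt hnondeg hN hodd inv hinj hEP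

/-! ## The local index at `v_p` from the `Λ`-clauses -/

/-- **`#𝓕_can(v_p) = p^{k+1} · #𝓚(v_p)`**: the dictionary's functional `Λ` is onto `ℤ/p^{k+1}` on
`𝓕_can(v_p)` with kernel the Kummer condition (`𝓚(v_p) ≤ 𝓕_can(v_p)`), so the index is `p^{k+1}`
([K22] Prop. 3.12: `H¹_s(ℚ_p, T)/I ≅ ℤ_p/I` free of rank one).
[cite: Kim2022StructureSelmer, Prop. 3.12 (arXiv p. 17)] -/
theorem natCard_propagated_inr_eq {v₀ : HeightOneSpectrum (𝓞 ℚ)}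
    (Λ : galoisCohomology ((W.torsionGaloisModule ((p : ℤ) ^ k * (p : ℤ))).toLocal (Sum.inr v₀)) 1
      →+ ZMod (p ^ (k + 1)))
    (hon : ∀ r : ZMod (p ^ (k + 1)), ∃ x ∈ propagatedSelmerStructure W p k (Sum.inr v₀), Λ x = r)
    (hker : ∀ x ∈ propagatedSelmerStructure W p k (Sum.inr v₀),
      Λ x = 0 ↔ x ∈ W.kummerSelmerStructure ((p : ℤ) ^ k * (p : ℤ)) (Sum.inr v₀))
    [Finite (propagatedSelmerStructure W p k (Sum.inr v₀))] :
    Nat.card (propagatedSelmerStructure W p k (Sum.inr v₀)) =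
      p ^ (k + 1) * Nat.card (W.kummerSelmerStructure ((p : ℤ) ^ k * (p : ℤ)) (Sum.inr v₀)) := by
  haveI : NeZero (p ^ (k + 1)) := ⟨pow_ne_zero _ hp.out.ne_zero⟩
  set F := propagatedSelmerStructure W p k (Sum.inr v₀) with hF
  set Kq := W.kummerSelmerStructure ((p : ℤ) ^ k * (p : ℤ)) (Sum.inr v₀) with hKq
  let Λ' : F →+ ZMod (p ^ (k + 1)) := Λ.comp F.subtype
  have hΛ' : ∀ x : F, Λ' x = Λ x := fun x => rfl
  -- kernel `= 𝓚(v_p)` inside `𝓕_can(v_p)`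
  have hle : Kq ≤ F := kummerSelmerStructure_le_propagatedSelmerStructure W p (Sum.inr v₀) k
  have hkerEq : Λ'.ker = Kq.addSubgroupOf F := by
    ext x
    rw [AddMonoidHom.mem_ker, AddSubgroup.mem_addSubgroupOf, hΛ']
    exact hker x.1 x.2
  have hkerCard : Nat.card Λ'.ker = Nat.card Kq := by
    rw [hkerEq]
    exact Nat.card_congr (AddSubgroup.addSubgroupOfEquivOfLe hle).toEquiv
  -- range `= ⊤`
  have hrange : Λ'.range = ⊤ := by
    rw [AddMonoidHom.range_eq_top]
    intro r
    obtain ⟨x, hx, hxr⟩ := hon r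
    exact ⟨⟨x, hx⟩, hxr⟩
  have hrangeCard : Nat.card Λ'.range = p ^ (k + 1) := by
    rw [hrange, AddSubgroup.card_top, Nat.card_zmod]
  rw [AddSubgroup.card_eq_card_quotient_mul_card_addSubgroup Λ'.ker,
    Nat.card_congr (QuotientAddGroup.quotientKerEquivRange Λ').toEquiv, hrangeCard, hkerCard]

/-- Local `H¹(K_v, M)` is finite at a finite place (generic number field; the tree's
`finite_galoisCohomology_one_of_isNonarchimedeanLocalField` read at `K_v = Place.Completion (inr v)`,
as in p13's `finite_pi_galoisCohomology_toLocal`). [folklore] -/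
theorem finite_galoisCohomology_toLocal_inr {K : Type} [Field K] [NumberField K] {M : Type}
    [AddCommGroup M] [TopologicalSpace M] [DiscreteTopology M] [Finite M]
    (ρ' : DiscreteGaloisModule K M) (v : HeightOneSpectrum (𝓞 K)) :
    Finite (galoisCohomology (ρ'.toLocal (Sum.inr v)) 1) := by
  haveI : CharZero (v.adicCompletion K) := charZero_adicCompletion v
  change Finite (galoisCohomology (GaloisRep.restrictField (v.adicCompletion K) ρ') 1)
  exact finite_galoisCohomology_one_of_isNonarchimedeanLocalField _

/-! ## The count -/

omit [W.IsElliptic] in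
/-- `H¹(ℚ_w, E[p^k · p]) = 0` at an infinite place for odd `p`: any two local conditions there
coincide. [cite: MilneADT2006, I Rem. 3.7] -/
theorem apply_inl_eq_of_odd (hp2 : p ≠ 2)
    (𝓛 𝓛' : SelmerStructure (W.torsionGaloisModule ((p : ℤ) ^ k * (p : ℤ)))) (w : InfinitePlace ℚ) :
    𝓛 (Sum.inl w) = 𝓛' (Sum.inl w) := by
  have hodd : Odd (((p : ℤ) ^ k * (p : ℤ)).natAbs) := by
    rw [Int.natAbs_mul, Int.natAbs_pow, Int.natAbs_natCast, ← pow_succ]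
    exact (hp.out.odd_of_ne_two hp2).pow
  have h0 : ∀ y : galoisCohomology ((W.torsionGaloisModule ((p : ℤ) ^ k * (p : ℤ))).toLocal
      (Sum.inl w)) 1, y = 0 := fun y =>
    eq_zero_of_odd_nsmul_eq_zero_infinitePlace w _ hodd y
      (galoisCohomology.nsmul_eq_zero_of_forall _ (fun T => W.natAbs_nsmul_geomTorsion T) y)
  ext y
  rw [h0 y]
  exact ⟨fun _ => zero_mem _, fun _ => zero_mem _⟩

/-- **The Poitou–Tate count for the propagated structure at the empty level:
`#H¹_{𝓕_can}(ℚ, E[p^{k+1}]) = p^{k+1} · #H¹_{𝓕_can^*}(ℚ, E[p^{k+1}]^D)`** (`p` odd), from p13's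
pair count for `𝓚 ≤ 𝓕_can`, the self-duality count `#H¹_𝓚 = #H¹_{𝓚^*}` and the local index
`[𝓕_can(v_p) : 𝓚(v_p)] = p^{k+1}`.  Binders: the Poitou–Tate family at the modulus `p^{k+1}` with
its four properties and injective local invariant maps; `hEP`; the `Λ`-clauses of the dictionary at
`v_p ∣ p`; a finite set `T ∋ v_p` of finite places off which `E[p^{k+1}]` is unramified and prime to
`p`; the classical Selmer group `H¹_𝓚 = Sel_{p^{k+1}}(E/ℚ)` finite.
[cite: MazurRubin2004, Prop. 2.3.5] [cite: Sakamoto2024, Def. 3.9 (p. 924)] -/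
theorem natCard_selmerGroup_propagated_eq (hp2 : p ≠ 2) {v₀ : HeightOneSpectrum (𝓞 ℚ)}
    (hv₀ : ((p : ℕ) : 𝓞 ℚ) ∈ v₀.asIdeal)
    [Finite (geomTorsion W ((p : ℤ) ^ k * (p : ℤ)))]
    (Λ : galoisCohomology ((W.torsionGaloisModule ((p : ℤ) ^ k * (p : ℤ))).toLocal (Sum.inr v₀)) 1
      →+ ZMod (p ^ (k + 1)))
    (hon : ∀ r : ZMod (p ^ (k + 1)), ∃ x ∈ propagatedSelmerStructure W p k (Sum.inr v₀), Λ x = r)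
    (hker : ∀ x ∈ propagatedSelmerStructure W p k (Sum.inr v₀),
      Λ x = 0 ↔ x ∈ W.kummerSelmerStructure ((p : ℤ) ^ k * (p : ℤ)) (Sum.inr v₀))
    (inv : LocalInvariants ℚ (p ^ (k + 1))) (hperf : inv.IsPerfect) (hsum : inv.SumLocalTermEqZero)
    (hcompl : inv.SelmerComplement)
    (hinj : ∀ v : HeightOneSpectrum (𝓞 ℚ), Injective (inv (Sum.inr v)))
    (hEP : ∀ v : HeightOneSpectrum (𝓞 ℚ), localEulerPoincareCharacteristic (v.adicCompletion ℚ))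
    (T : Finset (HeightOneSpectrum (𝓞 ℚ))) (hv₀T : v₀ ∈ T)
    (hT : ∀ v : HeightOneSpectrum (𝓞 ℚ), v ∉ T →
      (((p ^ (k + 1) : ℕ) : ℕ) : 𝓞 ℚ) ∉ v.asIdeal ∧
        GaloisRep.IsUnramifiedAt v (W.torsionGaloisModule ((p : ℤ) ^ k * (p : ℤ))))
    (h𝓕T : (propagatedSelmerStructure W p k).IsUnramifiedOutside (finSupport T))
    (h𝓚T : (W.kummerSelmerStructure ((p : ℤ) ^ k * (p : ℤ))).IsUnramifiedOutside (finSupport T))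
    [Finite (W.kummerSelmerStructure ((p : ℤ) ^ k * (p : ℤ))).selmerGroup] :
    Nat.card (propagatedSelmerStructure W p k).selmerGroup =
      p ^ (k + 1) * Nat.card (inv.dualSelmerStructure (W.torsionGaloisModule ((p : ℤ) ^ k * (p : ℤ)))
        (propagatedSelmerStructure W p k)).selmerGroup := by
  haveI : NeZero (p ^ (k + 1)) := ⟨pow_ne_zero _ hp.out.ne_zero⟩
  have hle : W.kummerSelmerStructure ((p : ℤ) ^ k * (p : ℤ)) ≤ propagatedSelmerStructure W p k :=
    fun v => kummerSelmerStructure_le_propagatedSelmerStructure W p v k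
  have hM : ∀ m : geomTorsion W ((p : ℤ) ^ k * (p : ℤ)), (p ^ (k + 1)) • m = 0 := fun T => by
    have h := W.natAbs_nsmul_geomTorsion T
    rwa [show ((p : ℤ) ^ k * (p : ℤ)).natAbs = p ^ (k + 1) by
      rw [Int.natAbs_mul, Int.natAbs_pow, Int.natAbs_natCast, pow_succ]] at h
  -- p13's pair count for `𝓚 ≤ 𝓕_can`
  have hpair := card_selmerGroup_pair (W.torsionGaloisModule ((p : ℤ) ^ k * (p : ℤ))) T inv hperf
    hsum hcompl hM hT hle h𝓚T h𝓕T (fun w => apply_inl_eq_of_odd W p k hp2 _ _ w)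
  -- the self-duality count `#H¹_𝓚 = #H¹_{𝓚^*}`
  have hKSD := natCard_selmerGroup_kummer_eq_dual_of_eq W ((p : ℤ) ^ k * (p : ℤ)) (p ^ (k + 1))
    (by push_cast; ring) (hp.out.isPrimePow.pow (Nat.succ_ne_zero k))
    ((hp.out.odd_of_ne_two hp2).pow) inv hinj hEP
  -- local terms: equal off `v₀`, index `p^{k+1}` at `v₀`
  haveI : ∀ v : HeightOneSpectrum (𝓞 ℚ), Finite (galoisCohomology
      ((W.torsionGaloisModule ((p : ℤ) ^ k * (p : ℤ))).toLocal (Sum.inr v)) 1) := fun v =>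
    finite_galoisCohomology_toLocal_inr _ v
  have hloc : ∀ v ∈ T, v ≠ v₀ →
      propagatedSelmerStructure W p k (Sum.inr v) =
        W.kummerSelmerStructure ((p : ℤ) ^ k * (p : ℤ)) (Sum.inr v) := by
    intro v _ hv
    have hpv : ((p : ℕ) : 𝓞 ℚ) ∉ v.asIdeal := fun h' =>
      hv (heightOneSpectrum_eq_of_natCast_mem hp.out h' hv₀)
    exact propagatedSelmerStructure_inr_eq_kummerSelmerStructure W p k hpv
  have hprod : ∏ v ∈ T, Nat.card (propagatedSelmerStructure W p k (Sum.inr v)) =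
      p ^ (k + 1) * ∏ v ∈ T, Nat.card (W.kummerSelmerStructure ((p : ℤ) ^ k * (p : ℤ)) (Sum.inr v)) := by
    rw [← Finset.mul_prod_erase T _ hv₀T, ← Finset.mul_prod_erase T _ hv₀T,
      natCard_propagated_inr_eq W p k Λ hon hker, mul_assoc]
    congr 2
    exact Finset.prod_congr rfl fun v hv => by
      rw [hloc v (Finset.mem_of_mem_erase hv) (Finset.ne_of_mem_erase hv)]
  -- cancel
  have hne1 : Nat.card (W.kummerSelmerStructure ((p : ℤ) ^ k * (p : ℤ))).selmerGroup ≠ 0 :=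
    Nat.card_pos.ne'
  have hne2 : ∏ v ∈ T, Nat.card (W.kummerSelmerStructure ((p : ℤ) ^ k * (p : ℤ)) (Sum.inr v)) ≠ 0 :=
    Finset.prod_ne_zero_iff.2 fun v _ => Nat.card_pos.ne'
  rw [hprod, ← hKSD] at hpair
  -- hpair : #𝓕 * #𝓚 * ∏𝓚_v = #𝓚 * #N * (p^{k+1} * ∏𝓚_v)
  have h := hpair
  have : Nat.card (propagatedSelmerStructure W p k).selmerGroup *
      (Nat.card (W.kummerSelmerStructure ((p : ℤ) ^ k * (p : ℤ))).selmerGroup *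
        ∏ v ∈ T, Nat.card (W.kummerSelmerStructure ((p : ℤ) ^ k * (p : ℤ)) (Sum.inr v))) =
      (p ^ (k + 1) * Nat.card (inv.dualSelmerStructure (W.torsionGaloisModule ((p : ℤ) ^ k * (p : ℤ)))
        (propagatedSelmerStructure W p k)).selmerGroup) *
      (Nat.card (W.kummerSelmerStructure ((p : ℤ) ^ k * (p : ℤ))).selmerGroup *
        ∏ v ∈ T, Nat.card (W.kummerSelmerStructure ((p : ℤ) ^ k * (p : ℤ)) (Sum.inr v))) := by
    rw [← mul_assoc, h]
    ring
  exact Nat.eq_of_mul_eq_mul_right (Nat.pos_of_ne_zero (mul_ne_zero hne1 hne2)) this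

end DeepLedger

end Summit.BirchSwinnertonDyer.Rank1Residual.GaloisImage

end
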